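import Mathlib.Tactic

/-!
# D-0122 AXIS B, knob k2 (LABEL SET), PARITY rows — the ODD label set `{1,3,5,…} ⊆ {1,…,l⋆}` is NOT closed under the label product, and the
# EVEN label set `{2,4,6,…} ⊆ {1,…,l⋆}` FAILS THE COSET TEST `a·b·c⁻¹ ∈ C`; so NEITHER parity label set is the orbit of a subgroup of the
# `𝔽_l^⋇`-symmetry (companion of `RHReqsideLabelsNoSymmetry` p513512, which is the truncation rows' face)

abc-iut cell, rung LADDER-ABC:A2.RESCUE.H. Statement and witnesses: abc-iut-reqb-rf-2 (GEN 4; D-0122 axis-B CONSISTENCY refuter k2/k3 + pairs/triples),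
post-letter hardening of the k2.parity word of the D-0121/D-0122 FINAL Part (II) (R/ROUND3/D0121-FINAL-1200Z.md c9ab8e0bbc43dc94, loci table row (5)
«k2 parity INCONSISTENT ⇒ NEW-THEORY (H) — [IUTchII] p.79, [IUTchIII] p.102/104»; REQB-CONSISTENCY-2.md v0.4 3eb4e142db689756 §k2.parity: «Everything under
k2.trunc applies as well (Q2-05, Q2-06, Q2-07)» — i.e. the symmetry leg), offered as an INPUT FILE to the k2 typer abc-iut-reqb-typ-2 / owner abc-iut-rh-lead;
PROOF-ONLY (0 definitions: the label of a residue `r` is written out as `min r (l − r)` exactly as in `RHReqsideLabelsNoSymmetry`). NOT a letter condition.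

THE ARITHMETIC (labels = `𝔽_l^⋇ = 𝔽_l^×/{±1}` represented by `{1,…,l⋆}`, `l⋆ = (l−1)/2`; the `𝔽_l^⋇`-symmetry of [IUTchI] Prop 4.9 (i) acts by
multiplication of residues; REQB-SPEC v0.2 ff7e3c55f4ddda0e k2 «parity» keeps the even labels, resp. the odd labels, at fixed `l`).
* A label subset that is the orbit of the label `1` under a subgroup `H ≤ 𝔽_l^⋇` is `H` itself, hence closed under the label product. The ODD set
  contains `1` and `3` (`l ≥ 7`); `oddLabels_three_mul_escapes`: with `x` = the largest odd label (`x = l⋆` if `l ≡ 3 (mod 4)`, `x = l⋆ − 1` if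
  `l ≡ 1 (mod 4)`), `l < 3x < 2l` and the label of `3·x` is `3x − l ∈ {l⋆ − 1, l⋆ − 4}`, which is EVEN and `≥ 1` — an explicit escaping product
  (prime `l ≥ 7`; primality is used only to exclude `l = 9`, where `3x = l`). `oddLabels_not_mul_closed`: so the odd set is not product-closed.
* A COSET `C = g·H` of a subgroup satisfies `a·b·c⁻¹ ∈ C` for all `a, b, c ∈ C`; for prime `l` every label is invertible, so this reads: for all
  `a, b, c ∈ C` and every residue `y` with `c·y ≡ a·b (mod l)`, the label of `y` lies in `C`. The EVEN set contains `2`, `4` and `b` = the largest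
  even label (`l⋆ ≥ 4`); `evenLabels_coset_test_fails`: `y := 2b` solves `2·y = 4·b` on the nose, `l⋆ < y = 2b ≤ l − 1`, and the label of `y` is
  `l − 2b ∈ {1, 3}`, which is ODD — so the even set is a coset of NO subgroup (`evenLabels_not_coset`; odd `l ≥ 9`, no primality needed).
* Degenerate moduli, recorded: `l = 5` (odd set `{1}`, even set `{2}`) and `l = 7` (even set `{2}`) give one-label sets, orbits of the trivial group;
  the tabulated torsion primes of the genuine bed v4.11 where a parity row is evaluated all have `l ≥ 7` (odd rows) / the even row's one-label case
  at `l = 7` carries no symmetry to lose.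
* The `𝔽_l^{⋊±}` side (labels `𝔽_l`, maps `x ↦ ±x + a`) is the orbit trichotomy `|orbit| ∈ {1, 2, l}` of the companion input file
  `RHReqsideLabelsPlusMinusOrbits` (reqb-rf-2 scratch ThetaPMOrbits.lean f0fde0879c374b68 of the FINAL, tree-shaped): the parity subsets of `𝔽_l`
  have `3 ≤ size ≤ l − 1` for `l ≥ 7` (`parityLabelsPM_card_window` below records the two cardinalities).
READING (the rf seats' CONSISTENCY column, recorded not adjudicated): like the truncations, the parity label sets of REQB-TABLE v1 b8ac679ede5d795b
(rows `parity:even`, `parity:odd`) are the orbit of no subgroup of either printed label symmetry — the symmetry leg of the word INCONSISTENT ⇒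
NEW-THEORY (H) for k2.parity; the print-native leg is [IUTchII] Rmk 2.6.3 (i)(a) p.79 «this subgraph Γ′ must be connected» (locus Q2-24).

HONEST FRAMING. Elementary arithmetic of residues modulo `l`; «label», «symmetry», «coset» are used in OUR typed currency; nothing here asserts that
abc is proved or refuted, that [IUTchIII] Cor. 3.12 / [IUTchIV] Thm. 1.10 holds or fails, or takes a side on any author; a parameter change of our
functional is not a claim that [IUTchI–III] admit it; typed ≠ proved; located ≠ adjudicated. [claim: Mochizuki2012, status: disputed] for the IUT
locutions ([IUTchI] Prop. 4.9 (i): the `𝔽_l^⋇`-torsor of labels). [folklore] for every statement below.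
-/

namespace Summit.ABC.IUTFork.Repair.RH.ReqsideLabelsParityNoSymmetry

/-- **The odd label set is not closed under the label product — explicit witness.** For prime `l ≥ 7` there is an ODD label `x ≤ l⋆` such that
`3·x mod l` is a nonzero residue whose label `min(3x mod l, l − (3x mod l))` is EVEN and lies in `[1, l⋆]` (while `3` is itself an odd label,
`3 ≤ l⋆`). Witness: `x = l⋆` when `l ≡ 3 (mod 4)` (label of `3x` = `l⋆ − 1`), `x = l⋆ − 1` when `l ≡ 1 (mod 4)` (label = `l⋆ − 4`; here `l ≥ 13`).
[folklore] -/
theorem oddLabels_three_mul_escapes (l : ℕ) (hp : l.Prime) (h7 : 7 ≤ l) :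
    ∃ x, x % 2 = 1 ∧ 1 ≤ x ∧ x ≤ (l - 1) / 2 ∧ 0 < 3 * x % l ∧ min (3 * x % l) (l - 3 * x % l) % 2 = 0 ∧
      1 ≤ min (3 * x % l) (l - 3 * x % l) ∧ min (3 * x % l) (l - 3 * x % l) ≤ (l - 1) / 2 := by
  have hodd : l % 2 = 1 := Nat.odd_iff.mp (hp.odd_of_ne_two (by omega))
  have h9 : l ≠ 9 := by rintro rfl; exact absurd hp (by norm_num)
  rcases Nat.lt_or_ge (l % 4) 2 with h4 | h4
  · -- l ≡ 1 (mod 4): l ≥ 13, x = l⋆ − 1 = (l − 3)/2, 3x − l = (l − 9)/2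
    have hl1 : l % 4 = 1 := by omega
    have h13 : 13 ≤ l := by omega
    refine ⟨(l - 3) / 2, by omega, by omega, by omega, ?_⟩
    have hm : 3 * ((l - 3) / 2) % l = 3 * ((l - 3) / 2) - l := by
      rw [Nat.mod_eq_sub_mod (show l ≤ 3 * ((l - 3) / 2) by omega), Nat.mod_eq_of_lt (show 3 * ((l - 3) / 2) - l < l by omega)]
    rw [hm]
    have hmin : min (3 * ((l - 3) / 2) - l) (l - (3 * ((l - 3) / 2) - l)) = 3 * ((l - 3) / 2) - l := min_eq_left (by omega)
    rw [hmin]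
    omega
  · -- l ≡ 3 (mod 4): x = l⋆ = (l − 1)/2, 3x − l = (l − 3)/2
    have hl3 : l % 4 = 3 := by omega
    refine ⟨(l - 1) / 2, by omega, by omega, le_rfl, ?_⟩
    have hm : 3 * ((l - 1) / 2) % l = 3 * ((l - 1) / 2) - l := by
      rw [Nat.mod_eq_sub_mod (show l ≤ 3 * ((l - 1) / 2) by omega), Nat.mod_eq_of_lt (show 3 * ((l - 1) / 2) - l < l by omega)]
    rw [hm]
    have hmin : min (3 * ((l - 1) / 2) - l) (l - (3 * ((l - 1) / 2) - l)) = 3 * ((l - 1) / 2) - l := min_eq_left (by omega)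
    rw [hmin]
    omega

/-- **Hence the odd label set `{x ∈ [1, l⋆] : x odd}` is NOT closed under the label product `(x, y) ↦ min(xy mod l, l − (xy mod l))`** (prime
`l ≥ 7`): the product of the odd labels `3` and `x` of `oddLabels_three_mul_escapes` has an even label. Since a subgroup orbit containing the label `1`
is the subgroup itself (product-closed), the odd set is the orbit of NO subgroup of the `𝔽_l^⋇`-symmetry; equivalently it fails the coset test
below with `c = 1`. [folklore] -/
theorem oddLabels_not_mul_closed (l : ℕ) (hp : l.Prime) (h7 : 7 ≤ l) :
    ¬ (∀ x y, (1 ≤ x ∧ x ≤ (l - 1) / 2 ∧ x % 2 = 1) → (1 ≤ y ∧ y ≤ (l - 1) / 2 ∧ y % 2 = 1) →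
        (1 ≤ min (x * y % l) (l - x * y % l) ∧ min (x * y % l) (l - x * y % l) ≤ (l - 1) / 2 ∧
          min (x * y % l) (l - x * y % l) % 2 = 1)) := by
  intro h
  obtain ⟨x, hxodd, hx1, hxl, _, heven, _, _⟩ := oddLabels_three_mul_escapes l hp h7
  have h3 := (h 3 x ⟨by norm_num, by omega, by norm_num⟩ ⟨hx1, hxl, hxodd⟩).2.2
  omega

/-- **The even label set fails the coset test — explicit witness.** For odd `l ≥ 9` (so `l⋆ ≥ 4`) there are EVEN labels `a = 4`, `b` (the largest
even label: `b = l⋆` if `l ≡ 1 (mod 4)`, `b = l⋆ − 1` if `l ≡ 3 (mod 4)`), `c = 2` and the residue `y = 2b` with `c·y = a·b` EXACTLY, `0 < y < l`,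
whose label `min(y, l − y) = l − 2b ∈ {1, 3}` is ODD. No primality needed. [folklore] -/
theorem evenLabels_coset_test_fails (l : ℕ) (hodd : l % 2 = 1) (h9 : 9 ≤ l) :
    ∃ a b c y, (1 ≤ a ∧ a ≤ (l - 1) / 2 ∧ a % 2 = 0) ∧ (1 ≤ b ∧ b ≤ (l - 1) / 2 ∧ b % 2 = 0) ∧ (1 ≤ c ∧ c ≤ (l - 1) / 2 ∧ c % 2 = 0) ∧
      c * y = a * b ∧ 0 < y % l ∧ min (y % l) (l - y % l) % 2 = 1 := by
  rcases Nat.lt_or_ge (l % 4) 2 with h4 | h4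
  · -- l ≡ 1 (mod 4): b = l⋆ = (l − 1)/2 (even), y = l − 1, label 1
    have hl1 : l % 4 = 1 := by omega
    refine ⟨4, (l - 1) / 2, 2, l - 1, ⟨by omega, by omega, by norm_num⟩, ⟨by omega, le_rfl, by omega⟩, ⟨by omega, by omega, by norm_num⟩,
      by omega, ?_, ?_⟩
    · rw [Nat.mod_eq_of_lt (show l - 1 < l by omega)]; omega
    · rw [Nat.mod_eq_of_lt (show l - 1 < l by omega)]
      have hmin : min (l - 1) (l - (l - 1)) = l - (l - 1) := min_eq_right (by omega)
      rw [hmin]; omega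
  · -- l ≡ 3 (mod 4): b = l⋆ − 1 = (l − 3)/2 (even), y = l − 3, label 3
    have hl3 : l % 4 = 3 := by omega
    refine ⟨4, (l - 3) / 2, 2, l - 3, ⟨by omega, by omega, by norm_num⟩, ⟨by omega, by omega, by omega⟩, ⟨by omega, by omega, by norm_num⟩,
      by omega, ?_, ?_⟩
    · rw [Nat.mod_eq_of_lt (show l - 3 < l by omega)]; omega
    · rw [Nat.mod_eq_of_lt (show l - 3 < l by omega)]
      have hmin : min (l - 3) (l - (l - 3)) = l - (l - 3) := min_eq_right (by omega)
      rw [hmin]; omega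

/-- **`evenLabels_not_coset` — the even label set `E = {x ∈ [1, l⋆] : x even}` is a coset of NO subgroup of `𝔽_l^⋇`** (odd `l ≥ 9`; for prime `l`
this is every tabulated torsion prime `l ≥ 11`), in the residue form of the coset test: it is FALSE that for all `a, b, c ∈ E` and every residue `y`
with `c·y ≡ a·b (mod l)` the label of `y` lies in `E`. (For a coset `g·H`, `H ≤ 𝔽_l^⋇`, and `a, b, c ∈ g·H`, any such `y` is `≡ ±a·b·c⁻¹ ∈ g·H`
because `c` is invertible modulo the prime `l`; so a set passing as a coset passes this test.) Witness `evenLabels_coset_test_fails`. [folklore] -/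
theorem evenLabels_not_coset (l : ℕ) (hodd : l % 2 = 1) (h9 : 9 ≤ l) :
    ¬ (∀ a b c y, (1 ≤ a ∧ a ≤ (l - 1) / 2 ∧ a % 2 = 0) → (1 ≤ b ∧ b ≤ (l - 1) / 2 ∧ b % 2 = 0) → (1 ≤ c ∧ c ≤ (l - 1) / 2 ∧ c % 2 = 0) →
        c * y % l = a * b % l →
        (1 ≤ min (y % l) (l - y % l) ∧ min (y % l) (l - y % l) ≤ (l - 1) / 2 ∧ min (y % l) (l - y % l) % 2 = 0)) := by
  intro h
  obtain ⟨a, b, c, y, ha, hb, hc, hcy, _, hlab⟩ := evenLabels_coset_test_fails l hodd h9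
  have := (h a b c y ha hb hc (by rw [hcy])).2.2
  omega

/-- **Uniqueness behind the coset test** (why one residue `y` suffices): for odd `l` the map `y ↦ 2·y` is injective modulo `l`, so the `y` of
`evenLabels_coset_test_fails` (`c = 2`) is the ONLY residue class with `c·y ≡ a·b`. [folklore] -/
theorem two_mul_mod_injective (l y y' : ℕ) (hodd : l % 2 = 1) (h : 2 * y % l = 2 * y' % l) : y % l = y' % l := by
  have hco : Nat.Coprime l 2 := (Nat.coprime_two_left.mpr (Nat.odd_iff.mpr hodd)).symm
  exact Nat.ModEq.cancel_left_of_coprime (c := 2) hco h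

/-- **The `𝔽_l^{⋊±}`-side cardinalities of the parity label sets of `𝔽_l = {−l⋆,…,l⋆}`** (`{0} ∪ {±even}` has `1 + 2·⌊l⋆/2⌋` elements, `{±odd}` has
`2·⌈l⋆/2⌉`): for `l ≥ 7` both lie in the window `[3, l − 1]`, so by the orbit trichotomy `|orbit| ∈ {1, 2, l}` of the `x ↦ ±x + a` maps
(`RHReqsideLabelsPlusMinusOrbits.affPM_no_midsize_orbit`) neither is the orbit of a subgroup of the `𝔽_l^{⋊±}`-symmetry. Pure arithmetic record of
the two sizes. [folklore] -/
theorem parityLabelsPM_card_window (l : ℕ) (hodd : l % 2 = 1) (h7 : 7 ≤ l) :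
    (3 ≤ 1 + 2 * (((l - 1) / 2) / 2) ∧ 1 + 2 * (((l - 1) / 2) / 2) ≤ l - 1) ∧
      (3 ≤ 2 * (((l - 1) / 2 + 1) / 2) ∧ 2 * (((l - 1) / 2 + 1) / 2) ≤ l - 1) := by
  omega

end Summit.ABC.IUTFork.Repair.RH.ReqsideLabelsParityNoSymmetry
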